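/-
Copyright (c) 2026. Released under Apache 2.0 license.
Literature formalization: Chen–Voutier, the three-term recurrence (2.9) for the diagonal Padé
polynomials.
-/
import Mathlib
import Literature.NumberTheory.DiophantineApproximation.BinomialPadeTaylorAtOne

/-!
# The three-term recurrence of the diagonal Padé polynomials of `x ^ α`

[cite: ChenVoutier1997, Lemma 1, recurrence (2.9) (arXiv:1401.5450, Lemma 2.3), in the
normalisation of Lemma 2]

J. H. Chen and P. M. Voutier, *Complete solution of the Diophantine equation `X² + 1 = dY⁴` and a
related family of quartic Thue equations*, J. Number Theory **62** (1997), 71–99.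

Thue's recurrence (2.9) of Lemma 1,
`λ (n(r+1)-1) A_{r+1} = (r + 1/2) Y₁ A_r - (nr+1) P² A_{r-1}` (and the same for `B_r`), expressed
through Lemma 1 (ii) (`(√λ)^r A_r = a X*_{n,r}(z,u) - b X*_{n,r}(u,z)`, `z - u = P`,
`z + u = Y₁/(2n√λ)`) is the three-term recurrence
`(n(r+1)-1) X*_{r+1} = n(2r+1)(z+u) X*_r - (nr+1)(z-u)² X*_{r-1}` for the homogenised
hypergeometric polynomials, i.e., with `α = 1/n` and in the normalisation
`p_r = C(r-α,r) X_{n,r}` of Lemma 2 (diagonal case `m = n = r`),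
`r(r+1) p_{r+1}(x) = r(2r+1)(x+1) p_r(x) - (r+α)(r-α)(x-1)² p_{r-1}(x)`     (`r ≥ 1`).
We prove this recurrence for the explicit polynomials
`p_r(x) = ∑_ν C(r-α,r-ν) C(r+α,ν) x^ν` and `q_r(x) = ∑_ν C(r-α,ν) C(r+α,r-ν) x^ν` and every real
`α` (`binomialPadeP_rec`, `binomialPadeQ_rec`), by comparing coefficients in the expansions at
`x = 1` of `BinomialPadeTaylorAtOne` (`p_r(x) = ∑_s C(r+α,s) C(2r-s,r) (x-1)^s`).  This is the
input needed for the non-vanishing of the Casoratian `p_{r+1} q_r - p_r q_{r+1}` (Lemma 7,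
`ApproximationSequenceMeasure.casoratian_ne_zero`).
-/

open Finset

namespace Literature.NumberTheory.DiophantineApproximation

/-! ### Rescaling rules for binomial coefficients -/

/-- `C(a+1,k+1) = (a+1)/(k+1) · C(a,k)` for real `a` [folklore]. -/
theorem ring_choose_succ_succ_eq_div_mul (a : ℝ) (k : ℕ) :
    Ring.choose (a + 1) (k + 1) = (a + 1) / (k + 1) * Ring.choose a k := by
  rw [ring_choose_eq_prod_div, ring_choose_eq_prod_div, prod_range_succ', Nat.factorial_succ,
    Nat.cast_zero, sub_zero]
  have hk : ((k.factorial : ℕ) : ℝ) ≠ 0 := by positivity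
  push_cast
  rw [show ∏ i ∈ range k, (a + 1 - ((i : ℝ) + 1)) = ∏ i ∈ range k, (a - i) from
    prod_congr rfl fun i _ => by ring]
  field_simp

/-- `C(a,k+1) = (a-k)/(k+1) · C(a,k)` for real `a` [folklore]. -/
theorem ring_choose_succ_eq_div_mul (a : ℝ) (k : ℕ) :
    Ring.choose a (k + 1) = (a - k) / (k + 1) * Ring.choose a k := by
  have h := succ_mul_ring_choose_succ a k
  have hk : ((k : ℝ) + 1) ≠ 0 := by positivity
  field_simp
  linear_combination h

/-- `C(n+1,k+1) = (n+1)/(k+1) · C(n,k)` (cast to `ℝ`) [folklore]. -/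
theorem natChoose_succ_succ_cast (n k : ℕ) :
    (((n + 1).choose (k + 1) : ℕ) : ℝ) = ((n : ℝ) + 1) / (k + 1) * (n.choose k : ℝ) := by
  have h := Nat.add_one_mul_choose_eq n k
  have h' : ((n : ℝ) + 1) * (n.choose k : ℝ) = ((n + 1).choose (k + 1) : ℝ) * ((k : ℝ) + 1) := by
    exact_mod_cast h
  have hk : ((k : ℝ) + 1) ≠ 0 := by positivity
  field_simp
  linear_combination -h'

/-- `C(n,k+1) = (n-k)/(k+1) · C(n,k)` for `k ≤ n` (cast to `ℝ`) [folklore]. -/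
theorem natChoose_succ_right_cast {n k : ℕ} (hk : k ≤ n) :
    ((n.choose (k + 1) : ℕ) : ℝ) = ((n : ℝ) - k) / (k + 1) * (n.choose k : ℝ) := by
  have h := Nat.choose_succ_right_eq n k
  have h' : (n.choose (k + 1) : ℝ) * ((k : ℝ) + 1) = (n.choose k : ℝ) * ((n : ℝ) - k) := by
    rw [← Nat.cast_sub hk]; exact_mod_cast h
  have hk1 : ((k : ℝ) + 1) ≠ 0 := by positivity
  field_simp
  linear_combination h'

/-! ### The coefficient identities -/

/-- Coefficient of `(x-1)^0` [cite: ChenVoutier1997, recurrence (2.9), normalised]. -/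
theorem padeTaylorCoeff_rec_zero (α : ℝ) (t : ℕ) :
    ((t : ℝ) + 1) * (t + 2) * (Ring.choose ((((t + 2 : ℕ)) : ℝ) + α) 0 *
        ((2 * (t + 2) - 0).choose (t + 2) : ℝ)) =
      ((t : ℝ) + 1) * (2 * t + 3) * (2 * (Ring.choose ((((t + 1 : ℕ)) : ℝ) + α) 0 *
        ((2 * (t + 1) - 0).choose (t + 1) : ℝ))) := by
  simp only [Ring.choose_zero_right, one_mul, Nat.sub_zero]
  have h := Nat.succ_mul_centralBinom_succ (t + 1)
  rw [Nat.centralBinom_eq_two_mul_choose, Nat.centralBinom_eq_two_mul_choose] at h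
  have h' : ((t : ℝ) + 1 + 1) * ((2 * (t + 1 + 1)).choose (t + 1 + 1) : ℝ) =
      2 * (2 * (t + 1) + 1) * ((2 * (t + 1)).choose (t + 1) : ℝ) := by exact_mod_cast h
  rw [show t + 2 = t + 1 + 1 from rfl]
  linear_combination ((t : ℝ) + 1) * h'

/-- Coefficient of `(x-1)^1` [cite: ChenVoutier1997, recurrence (2.9), normalised]. -/
theorem padeTaylorCoeff_rec_one (α : ℝ) (t : ℕ) :
    ((t : ℝ) + 1) * (t + 2) * (Ring.choose ((((t + 2 : ℕ)) : ℝ) + α) 1 *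
        ((2 * (t + 2) - 1).choose (t + 2) : ℝ)) =
      ((t : ℝ) + 1) * (2 * t + 3) * (Ring.choose ((((t + 1 : ℕ)) : ℝ) + α) 0 *
        ((2 * (t + 1) - 0).choose (t + 1) : ℝ) + 2 * (Ring.choose ((((t + 1 : ℕ)) : ℝ) + α) 1 *
        ((2 * (t + 1) - 1).choose (t + 1) : ℝ))) := by
  simp only [Ring.choose_zero_right, Ring.choose_one_right, one_mul, Nat.sub_zero]
  rw [show 2 * (t + 2) - 1 = 2 * t + 1 + 1 + 1 by omega, show t + 2 = t + 1 + 1 from rfl,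
    natChoose_succ_succ_cast, natChoose_succ_succ_cast,
    show 2 * (t + 1) = 2 * t + 1 + 1 by ring, natChoose_succ_succ_cast,
    show 2 * t + 1 + 1 - 1 = 2 * t + 1 by omega,
    natChoose_succ_right_cast (by omega : t ≤ 2 * t + 1)]
  have h1 : ((t : ℝ) + 1) ≠ 0 := by positivity
  have h2 : ((t : ℝ) + 1 + 1) ≠ 0 := by positivity
  push_cast
  field_simp
  ring

/-- Coefficient of `(x-1)^{i+2}`, `i ≤ t` [cite: ChenVoutier1997, recurrence (2.9), normalised]. -/
theorem padeTaylorCoeff_rec_succ_succ (α : ℝ) {t i : ℕ} (hi : i ≤ t) :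
    ((t : ℝ) + 1) * (t + 2) * (Ring.choose ((((t + 2 : ℕ)) : ℝ) + α) (i + 2) *
        ((2 * (t + 2) - (i + 2)).choose (t + 2) : ℝ)) =
      ((t : ℝ) + 1) * (2 * t + 3) * (Ring.choose ((((t + 1 : ℕ)) : ℝ) + α) (i + 1) *
        ((2 * (t + 1) - (i + 1)).choose (t + 1) : ℝ) +
        2 * (Ring.choose ((((t + 1 : ℕ)) : ℝ) + α) (i + 2) *
          ((2 * (t + 1) - (i + 2)).choose (t + 1) : ℝ))) -
      (((t : ℝ) + 1) ^ 2 - α ^ 2) * (Ring.choose ((t : ℝ) + α) i * ((2 * t - i).choose t : ℝ)) := by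
  -- the real binomials in terms of `B = C(t+α, i)`
  have eB1 : Ring.choose ((((t + 1 : ℕ)) : ℝ) + α) (i + 1) =
      ((t : ℝ) + 1 + α) / (i + 1) * Ring.choose ((t : ℝ) + α) i := by
    rw [show (((t + 1 : ℕ)) : ℝ) + α = ((t : ℝ) + α) + 1 by push_cast; ring,
      ring_choose_succ_succ_eq_div_mul]
    ring
  have eB2 : Ring.choose ((((t + 2 : ℕ)) : ℝ) + α) (i + 2) =
      ((t : ℝ) + 2 + α) / (i + 2) * (((t : ℝ) + 1 + α) / (i + 1)) * Ring.choose ((t : ℝ) + α) i := by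
    rw [show (((t + 2 : ℕ)) : ℝ) + α = ((t : ℝ) + α + 1) + 1 by push_cast; ring,
      ring_choose_succ_succ_eq_div_mul, ring_choose_succ_succ_eq_div_mul]
    push_cast
    ring
  have eB3 : Ring.choose ((((t + 1 : ℕ)) : ℝ) + α) (i + 2) =
      ((t : ℝ) + 1 + α) / (i + 2) * (((t : ℝ) + α - i) / (i + 1)) * Ring.choose ((t : ℝ) + α) i := by
    rw [show (((t + 1 : ℕ)) : ℝ) + α = ((t : ℝ) + α) + 1 by push_cast; ring,
      ring_choose_succ_succ_eq_div_mul, ring_choose_succ_eq_div_mul]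
    push_cast
    ring
  rcases hi.lt_or_eq with hlt | rfl
  · -- generic case `i < t`: all four natural binomials in terms of `D = C(2t-i, t)`
    obtain ⟨N, hN⟩ : ∃ N : ℕ, 2 * t - i = N := ⟨_, rfl⟩
    have hNt : t + 1 ≤ N := by omega
    have hNreal : (N : ℝ) = 2 * t - i := by
      rw [← hN, Nat.cast_sub (by omega)]; push_cast; ring
    rw [show 2 * (t + 2) - (i + 2) = N + 1 + 1 by omega, show t + 2 = t + 1 + 1 from rfl,
      natChoose_succ_succ_cast, natChoose_succ_succ_cast,
      show 2 * (t + 1) - (i + 1) = N + 1 by omega, natChoose_succ_succ_cast,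
      show 2 * (t + 1) - (i + 2) = N by omega, natChoose_succ_right_cast (by omega : t ≤ N),
      hN, eB1, eB2, eB3]
    have h1 : ((t : ℝ) + 1) ≠ 0 := by positivity
    have h2 : ((t : ℝ) + 1 + 1) ≠ 0 := by positivity
    have h3 : ((i : ℝ) + 1) ≠ 0 := by positivity
    have h4 : ((i : ℝ) + 2) ≠ 0 := by positivity
    push_cast
    rw [hNreal]
    field_simp
    ring
  · -- edge case `i = t`
    rw [show 2 * (i + 2) - (i + 2) = i + 2 by omega, show 2 * (i + 1) - (i + 1) = i + 1 by omega,
      show 2 * (i + 1) - (i + 2) = i by omega, show 2 * i - i = i by omega, Nat.choose_self,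
      Nat.choose_self, Nat.choose_self, Nat.choose_succ_self, eB1, eB2]
    have h1 : ((i : ℝ) + 1) ≠ 0 := by positivity
    have h4 : ((i : ℝ) + 2) ≠ 0 := by positivity
    push_cast
    field_simp
    ring

/-! ### The recurrence in the Taylor basis at `x = 1` -/

/-- The recurrence for the expansions at `1`: with `a_r(s) = C(r+α,s) C(2r-s,r)` and any complex
`y` (think `y = x - 1`),
`(t+1)(t+2) ∑_s a_{t+2}(s) y^s = (t+1)(2t+3)(y+2) ∑_s a_{t+1}(s) y^s - ((t+1)²-α²) y² ∑_s a_t(s) y^s`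
[cite: ChenVoutier1997, recurrence (2.9), in the normalisation of Lemma 2]. -/
theorem padeTaylor_rec (α : ℝ) (t : ℕ) (y : ℂ) :
    ((t : ℂ) + 1) * (t + 2) * ∑ s ∈ range (t + 3), ((Ring.choose ((((t + 2 : ℕ)) : ℝ) + α) s *
        ((2 * (t + 2) - s).choose (t + 2) : ℝ) : ℝ) : ℂ) * y ^ s =
      ((t : ℂ) + 1) * (2 * t + 3) * (y + 2) * ∑ s ∈ range (t + 2),
        ((Ring.choose ((((t + 1 : ℕ)) : ℝ) + α) s * ((2 * (t + 1) - s).choose (t + 1) : ℝ) : ℝ) :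
          ℂ) * y ^ s -
      (((t : ℂ) + 1) ^ 2 - (α : ℂ) ^ 2) * y ^ 2 * ∑ s ∈ range (t + 1),
        ((Ring.choose ((t : ℝ) + α) s * ((2 * t - s).choose t : ℝ) : ℝ) : ℂ) * y ^ s := by
  -- the three coefficient sequences
  obtain ⟨A2, hA2⟩ : ∃ A2 : ℕ → ℝ, A2 = fun s => Ring.choose ((((t + 2 : ℕ)) : ℝ) + α) s *
      ((2 * (t + 2) - s).choose (t + 2) : ℝ) := ⟨_, rfl⟩
  obtain ⟨A1, hA1⟩ : ∃ A1 : ℕ → ℝ, A1 = fun s => Ring.choose ((((t + 1 : ℕ)) : ℝ) + α) s *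
      ((2 * (t + 1) - s).choose (t + 1) : ℝ) := ⟨_, rfl⟩
  obtain ⟨A0, hA0⟩ : ∃ A0 : ℕ → ℝ, A0 = fun s => Ring.choose ((t : ℝ) + α) s *
      ((2 * t - s).choose t : ℝ) := ⟨_, rfl⟩
  have fold2 : ∀ s, ((Ring.choose ((((t + 2 : ℕ)) : ℝ) + α) s *
      ((2 * (t + 2) - s).choose (t + 2) : ℝ) : ℝ) : ℂ) = (A2 s : ℂ) := by intro s; rw [hA2]
  have fold1 : ∀ s, ((Ring.choose ((((t + 1 : ℕ)) : ℝ) + α) s *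
      ((2 * (t + 1) - s).choose (t + 1) : ℝ) : ℝ) : ℂ) = (A1 s : ℂ) := by intro s; rw [hA1]
  have fold0 : ∀ s, ((Ring.choose ((t : ℝ) + α) s * ((2 * t - s).choose t : ℝ) : ℝ) : ℂ) =
      (A0 s : ℂ) := by intro s; rw [hA0]
  simp only [fold2, fold1, fold0]
  -- decompositions of the three sums
  have dL : ∑ s ∈ range (t + 3), (A2 s : ℂ) * y ^ s =
      ∑ i ∈ range (t + 1), (A2 (i + 2) : ℂ) * y ^ (i + 2) + (A2 1 : ℂ) * y + A2 0 := by
    rw [sum_range_succ', sum_range_succ']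
    ring
  have dM1 : y * ∑ s ∈ range (t + 2), (A1 s : ℂ) * y ^ s =
      ∑ i ∈ range (t + 1), (A1 (i + 1) : ℂ) * y ^ (i + 2) + (A1 0 : ℂ) * y := by
    rw [mul_sum, sum_range_succ']
    simp only [pow_zero, mul_one]
    congr 1
    · exact sum_congr rfl fun i _ => by ring
    · ring
  have hA1van : A1 (t + 2) = 0 := by
    rw [hA1]
    dsimp only
    rw [show 2 * (t + 1) - (t + 2) = t by omega, Nat.choose_succ_self, Nat.cast_zero, mul_zero]
  have dM2 : ∑ s ∈ range (t + 2), (A1 s : ℂ) * y ^ s =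
      ∑ i ∈ range (t + 1), (A1 (i + 2) : ℂ) * y ^ (i + 2) + (A1 1 : ℂ) * y + A1 0 := by
    rw [sum_range_succ (fun i => (A1 (i + 2) : ℂ) * y ^ (i + 2)) t, hA1van, Complex.ofReal_zero,
      zero_mul, add_zero, sum_range_succ', sum_range_succ']
    ring
  have dS : y ^ 2 * ∑ s ∈ range (t + 1), (A0 s : ℂ) * y ^ s =
      ∑ i ∈ range (t + 1), (A0 i : ℂ) * y ^ (i + 2) := by
    rw [mul_sum]
    exact sum_congr rfl fun i _ => by ring
  -- the coefficient identities
  have key : ((t : ℂ) + 1) * (t + 2) * ∑ i ∈ range (t + 1), (A2 (i + 2) : ℂ) * y ^ (i + 2) -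
      ((t : ℂ) + 1) * (2 * t + 3) * ∑ i ∈ range (t + 1), (A1 (i + 1) : ℂ) * y ^ (i + 2) -
      2 * (((t : ℂ) + 1) * (2 * t + 3)) * ∑ i ∈ range (t + 1), (A1 (i + 2) : ℂ) * y ^ (i + 2) +
      (((t : ℂ) + 1) ^ 2 - (α : ℂ) ^ 2) * ∑ i ∈ range (t + 1), (A0 i : ℂ) * y ^ (i + 2) = 0 := by
    rw [mul_sum, mul_sum, mul_sum, mul_sum, ← sum_sub_distrib, ← sum_sub_distrib,
      ← sum_add_distrib]
    refine sum_eq_zero fun i hi => ?_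
    have h := padeTaylorCoeff_rec_succ_succ α (Nat.lt_succ_iff.mp (mem_range.mp hi))
    have h' := congrArg (fun r : ℝ => (r : ℂ)) h
    simp only [hA2, hA1, hA0]
    push_cast at h' ⊢
    linear_combination y ^ (i + 2) * h'
  have k1 := congrArg (fun r : ℝ => (r : ℂ)) (padeTaylorCoeff_rec_one α t)
  have k0 := congrArg (fun r : ℝ => (r : ℂ)) (padeTaylorCoeff_rec_zero α t)
  simp only [hA2, hA1, hA0] at dL dM1 dM2 dS key ⊢
  push_cast at k1 k0 dL dM1 dM2 dS key ⊢
  linear_combination ((t : ℂ) + 1) * (t + 2) * dL - ((t : ℂ) + 1) * (2 * t + 3) * dM1 -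
    2 * (((t : ℂ) + 1) * (2 * t + 3)) * dM2 + (((t : ℂ) + 1) ^ 2 - (α : ℂ) ^ 2) * dS + key +
    y * k1 + k0

/-! ### The recurrence for `p_r` and `q_r` -/

/-- **Three-term recurrence for the diagonal Padé numerators** [cite: ChenVoutier1997, Lemma 1,
recurrence (2.9), in the normalisation `p_r = C(r-α,r) X_{n,r}` of Lemma 2]: for every `t : ℕ` and
complex `x`, with `p_r(x) = ∑_{ν=0}^{r} C(r-α,r-ν) C(r+α,ν) x^ν`,
`(t+1)(t+2) p_{t+2}(x) = (t+1)(2t+3)(x+1) p_{t+1}(x) - ((t+1)²-α²)(x-1)² p_t(x)`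
(i.e. `r(r+1) p_{r+1} = r(2r+1)(x+1) p_r - (r²-α²)(x-1)² p_{r-1}` with `r = t+1 ≥ 1`). -/
theorem binomialPadeP_rec (α : ℝ) (t : ℕ) (x : ℂ) :
    ((t : ℂ) + 1) * (t + 2) * ∑ ν ∈ range (t + 2 + 1),
        ((Ring.choose ((((t + 2 : ℕ)) : ℝ) - α) (t + 2 - ν) *
          Ring.choose ((((t + 2 : ℕ)) : ℝ) + α) ν : ℝ) : ℂ) * x ^ ν =
      ((t : ℂ) + 1) * (2 * t + 3) * (x + 1) * ∑ ν ∈ range (t + 1 + 1),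
        ((Ring.choose ((((t + 1 : ℕ)) : ℝ) - α) (t + 1 - ν) *
          Ring.choose ((((t + 1 : ℕ)) : ℝ) + α) ν : ℝ) : ℂ) * x ^ ν -
      (((t : ℂ) + 1) ^ 2 - (α : ℂ) ^ 2) * (x - 1) ^ 2 * ∑ ν ∈ range (t + 1),
        ((Ring.choose ((t : ℝ) - α) (t - ν) * Ring.choose ((t : ℝ) + α) ν : ℝ) : ℂ) * x ^ ν := by
  rw [binomialPadeP_eq_sum_pow_sub_one α (t + 2) (t + 2) x,
    binomialPadeP_eq_sum_pow_sub_one α (t + 1) (t + 1) x, binomialPadeP_eq_sum_pow_sub_one α t t x]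
  have e : ∀ R : ℕ, ∑ s ∈ range (R + 1), ((Ring.choose ((R : ℝ) + α) s *
      Ring.choose ((R : ℝ) + R - s) R : ℝ) : ℂ) * (x - 1) ^ s =
      ∑ s ∈ range (R + 1), ((Ring.choose ((R : ℝ) + α) s * ((2 * R - s).choose R : ℝ) : ℝ) : ℂ) *
        (x - 1) ^ s := fun R =>
    sum_congr rfl fun s hs => by
      rw [ring_choose_two_mul_sub R s (Nat.lt_succ_iff.mp (mem_range.mp hs))]
  rw [e, e, e]
  have h := padeTaylor_rec α t (x - 1)
  rw [show x - 1 + 2 = x + 1 by ring] at h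
  exact h

/-- **Three-term recurrence for the diagonal Padé denominators** [cite: ChenVoutier1997,
Lemma 1, recurrence (2.9), in the normalisation of Lemma 2]: the polynomials
`q_r(x) = ∑_{ν=0}^{r} C(r-α,ν) C(r+α,r-ν) x^ν` satisfy the same recurrence as the `p_r`,
`(t+1)(t+2) q_{t+2}(x) = (t+1)(2t+3)(x+1) q_{t+1}(x) - ((t+1)²-α²)(x-1)² q_t(x)`. -/
theorem binomialPadeQ_rec (α : ℝ) (t : ℕ) (x : ℂ) :
    ((t : ℂ) + 1) * (t + 2) * ∑ ν ∈ range (t + 2 + 1),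
        ((Ring.choose ((((t + 2 : ℕ)) : ℝ) - α) ν *
          Ring.choose ((((t + 2 : ℕ)) : ℝ) + α) (t + 2 - ν) : ℝ) : ℂ) * x ^ ν =
      ((t : ℂ) + 1) * (2 * t + 3) * (x + 1) * ∑ ν ∈ range (t + 1 + 1),
        ((Ring.choose ((((t + 1 : ℕ)) : ℝ) - α) ν *
          Ring.choose ((((t + 1 : ℕ)) : ℝ) + α) (t + 1 - ν) : ℝ) : ℂ) * x ^ ν -
      (((t : ℂ) + 1) ^ 2 - (α : ℂ) ^ 2) * (x - 1) ^ 2 * ∑ ν ∈ range (t + 1),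
        ((Ring.choose ((t : ℝ) - α) ν * Ring.choose ((t : ℝ) + α) (t - ν) : ℝ) : ℂ) * x ^ ν := by
  have h := binomialPadeP_rec (-α) t x
  have e : ∀ (R ν : ℕ), Ring.choose ((R : ℝ) - -α) (R - ν) * Ring.choose ((R : ℝ) + -α) ν =
      Ring.choose ((R : ℝ) - α) ν * Ring.choose ((R : ℝ) + α) (R - ν) := by
    intro R ν
    rw [sub_neg_eq_add, ← sub_eq_add_neg, mul_comm]
  simp only [e, Complex.ofReal_neg, neg_sq] at h
  exact h

/-- `binomialPadeP_rec` indexed as in [cite: ChenVoutier1997, (2.9)]: for `r ≥ 1`,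
`r(r+1) p_{r+1}(x) = r(2r+1)(x+1) p_r(x) - (r²-α²)(x-1)² p_{r-1}(x)`. -/
theorem binomialPadeP_rec' (α : ℝ) {r : ℕ} (hr : 1 ≤ r) (x : ℂ) :
    (r : ℂ) * (r + 1) * ∑ ν ∈ range (r + 1 + 1),
        ((Ring.choose ((((r + 1 : ℕ)) : ℝ) - α) (r + 1 - ν) *
          Ring.choose ((((r + 1 : ℕ)) : ℝ) + α) ν : ℝ) : ℂ) * x ^ ν =
      (r : ℂ) * (2 * r + 1) * (x + 1) * ∑ ν ∈ range (r + 1),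
        ((Ring.choose ((r : ℝ) - α) (r - ν) * Ring.choose ((r : ℝ) + α) ν : ℝ) : ℂ) * x ^ ν -
      ((r : ℂ) ^ 2 - (α : ℂ) ^ 2) * (x - 1) ^ 2 * ∑ ν ∈ range (r - 1 + 1),
        ((Ring.choose ((((r - 1 : ℕ)) : ℝ) - α) (r - 1 - ν) *
          Ring.choose ((((r - 1 : ℕ)) : ℝ) + α) ν : ℝ) : ℂ) * x ^ ν := by
  obtain ⟨k, rfl⟩ : ∃ k, r = k + 1 := ⟨r - 1, by omega⟩
  have h := binomialPadeP_rec α k x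
  simp only [Nat.add_sub_cancel]
  rw [show k + 1 + 1 = k + 2 from rfl]
  have e : ((k + 1 : ℕ) : ℂ) = (k : ℂ) + 1 := by push_cast; ring
  rw [e]
  linear_combination h

/-- `binomialPadeQ_rec` indexed as in [cite: ChenVoutier1997, (2.9)]: for `r ≥ 1`,
`r(r+1) q_{r+1}(x) = r(2r+1)(x+1) q_r(x) - (r²-α²)(x-1)² q_{r-1}(x)`. -/
theorem binomialPadeQ_rec' (α : ℝ) {r : ℕ} (hr : 1 ≤ r) (x : ℂ) :
    (r : ℂ) * (r + 1) * ∑ ν ∈ range (r + 1 + 1),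
        ((Ring.choose ((((r + 1 : ℕ)) : ℝ) - α) ν *
          Ring.choose ((((r + 1 : ℕ)) : ℝ) + α) (r + 1 - ν) : ℝ) : ℂ) * x ^ ν =
      (r : ℂ) * (2 * r + 1) * (x + 1) * ∑ ν ∈ range (r + 1),
        ((Ring.choose ((r : ℝ) - α) ν * Ring.choose ((r : ℝ) + α) (r - ν) : ℝ) : ℂ) * x ^ ν -
      ((r : ℂ) ^ 2 - (α : ℂ) ^ 2) * (x - 1) ^ 2 * ∑ ν ∈ range (r - 1 + 1),
        ((Ring.choose ((((r - 1 : ℕ)) : ℝ) - α) ν *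
          Ring.choose ((((r - 1 : ℕ)) : ℝ) + α) (r - 1 - ν) : ℝ) : ℂ) * x ^ ν := by
  obtain ⟨k, rfl⟩ : ∃ k, r = k + 1 := ⟨r - 1, by omega⟩
  have h := binomialPadeQ_rec α k x
  simp only [Nat.add_sub_cancel]
  rw [show k + 1 + 1 = k + 2 from rfl]
  have e : ((k + 1 : ℕ) : ℂ) = (k : ℂ) + 1 := by push_cast; ring
  rw [e]
  linear_combination h

end Literature.NumberTheory.DiophantineApproximation
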